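/-
Copyright (c) 2026. All rights reserved.
Released under Apache 2.0 license as described in the file LICENSE.
-/
import Literature.Probability.FitznerVanDerHofstad2017.NobleBoundsN1Class00
import Literature.Probability.FitznerVanDerHofstad2017.NobleBoundsN1Cls02
import HarnessLib

/-!
# Fitzner–van der Hofstad (2017), §6.1 for `Ξ^{(1),ι}` — the contribution of `F^{ι,III}_0`

[FvdH17] = R. Fitzner, R. van der Hofstad, *Mean-field behavior for nearest-neighbor percolation in `d > 10`*,
Electron. J. Probab. **22** (2017), no. 43, arXiv:1506.07977v2.

`Ξ^{(1),ι}(x) = Ξ^{b_ι,(1)}(0,x;{e_ι}) + p 𝔼_0^{b_ι}[𝟙{e_ι ∉ C̃^{b_ι}_0(0)} Ξ^{B(0),(0)}(e_ι,x;C̃^{b_ι}_0(0))]`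
((3.55), `b_ι = (0,e_ι)`).  The second summand — bounded in [FvdH17] through the event `F^{ι,III}_0` of (4.67)
("If `F^{ι,III}_0` occurs, then we have `w = u = 0` and `κ = ι`", §6.1 proof of Lemma 5.3, v2 p. 59) — is
LITERALLY the `b₀ = b_ι` term of the two-level representation of `Ξ^{(1)}(x)` (`NobleJointTwoLevel`):
`𝔼_0^{b_ι}[𝟙{e_ι ∉ C̃^{b_ι}_0(0)} Ξ^{B(0),(0)}(e_ι,x;C̃)] = (ℙ_p ⊗ ℙ_p)(twoLevel (0,e_ι) x)`, because the
level-`0` cell `E'(0,0;{0})` of `Ξ^{(1)}` at `b₀ = (0,e_ι)` is the sure event and `C̃^{b_ι}_0(0)` does not read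
the bond `b_ι` (`nobleIotaCorr_zero_eq_prod_twoLevel`, with `NoblePercolationSplit.mem_nobleCell_origin_iff`).
Consequently the whole §6.1 machinery for `Ξ^{(1)}` applies verbatim to this part:

* `jointWitIII ι z t x = {b_ι occupied on level 0} ∩ jointWit (0,e_ι) 0 z t x` — the two-level bounding event of
  the `F^{ι,III}_0` part (the explicit factor `p` of (3.55) is absorbed into the line `{0 ←1̲→ e_ι}` by the
  bond-absorption lemma of `NobleBoundsN1ClassTools`), and
  `p 𝔼_0^{b_ι}[…] ≤ Σ_{z,t} ℙ_p^{⊗2}(jointWitIII ι z t x)` (`ofReal_mul_nobleIotaCorr_zero_le`) — the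
  `E₃`-half of hypothesis `h1` of `NobleBoundsN1IotaClasses.nobleXiIotaT_one_le_blocks_of_cls`
  (`nobleXiIotaT_one_le_add_partIII`);
* `jointWitIII_cls_of` — hypothesis `h3 b` of that assembly (`ℙ_p^{⊗2}(E₃ ∩ class b) ≤ Ā'^{ι,0,b}(0,0,t,z)
  P^{E,b}(t−x,z−x)`) follows from the class estimate `(0,b)` of `Ξ^{(1)}` at `(u,v,w) = (0,e_ι,0)`
  (`P^{S,0}(0,0) = 1`, `𝟙{e_ι = 0 + e_κ} = δ_{κ,ι}`); instantiated for `b = 0` (`NobleBoundsN1Class00`) and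
  `b = 2` (`NobleBoundsN1Cls02`) — `b = 1` is the same one-liner once the class `(0,1)` module is in the tree.

No named fact, no numeral, no dimension is fixed; nothing here is a cited hypothesis.
-/

noncomputable section

namespace Literature.Probability.FitznerVanDerHofstad2017

open _root_.MeasureTheory Literature.Barriers.CriticalPhenomena Literature.Probability.Percolation
open Literature.Probability.LatticeModels _root_.SimpleGraph
open Literature.Probability.FitznerVanDerHofstad2017.NobleBlocks
open Literature.Probability.FitznerVanDerHofstad2017.NobleBlocks.LenIdx
open scoped ENNReal

variable {d : ℕ}

/-! ### A. The `F^{ι,III}_0` part of (3.55) at `N = 1` is the `b₀ = b_ι` term of `Ξ^{(1)}` -/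

/-- **`𝔼_0^{b_ι}[𝟙{e ∉ C̃^{b_ι}_0(0)} Ξ^{B(0),(0)}(e,x;C̃^{b_ι}_0(0))] = (ℙ_p ⊗ ℙ_p)(twoLevel (0,e) x)`** (exact):
the second summand of (3.55) at `N = 1` is the `b₀ = (0,e)` term of the two-level representation of `Ξ^{(1)}`.
[cite: FitznerVanDerHofstad2017, (3.55) with (3.23), (3.31) (arXiv:1506.07977v2 pp. 30, 25, 27)] -/
theorem nobleIotaCorr_zero_eq_prod_twoLevel (p : unitInterval) (e x : Site d) :
    nobleIotaCorr d p e (fun C => nobleXiBT d p (bondsAt {0}) {0} 0 C e x) =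
      ((bondPercolation (zdGraph d) p).prod (bondPercolation (zdGraph d) p)) (twoLevel 0 e x) := by
  rw [nobleIotaCorr_eq, Measure.prod_apply (measurableSet_twoLevel 0 e x)]
  refine lintegral_congr fun ω => ?_
  by_cases he : e ∈ restrCluster 0 e 0 ω
  · rw [Set.indicator_of_notMem
      (show ω ∉ {ω : BondConfig (Site d) | e ∉ restrCluster 0 e 0 ω} from fun h => h he)]
    have hpre : Prod.mk ω ⁻¹' twoLevel 0 e x = ∅ :=
      Set.eq_empty_iff_forall_notMem.2 fun ω₁ h => ((mem_nobleCell_origin_iff e ω).1 h.1) he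
    rw [hpre, measure_empty]
  · rw [Set.indicator_of_mem (show ω ∈ {ω : BondConfig (Site d) | e ∉ restrCluster 0 e 0 ω} from he),
      nobleXiBT_zero, probOff_def]
    congr 1
    ext ω₁
    simp only [mem_occursOff_iff, Set.mem_preimage, twoLevel, Set.mem_setOf_eq, offBonds_empty,
      Set.union_empty]
    exact ⟨fun h => ⟨(mem_nobleCell_origin_iff e ω).2 he, h⟩, fun h => h.2⟩

/-! ### B. The two-level bounding event of the `F^{ι,III}_0` part -/

/-- **The bounding event of the `F^{ι,III}_0` part**: `b_ι = (0,e_ι)` occupied on level `0` and the joint event of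
`Ξ^{(1)}` for `b₀ = b_ι`, `w₀ = 0` (`F^{ι,III}_0 = {0 ↔ z₁} ∘ {b_ι occupied}`, level `1` as for `Ξ^{(1)}`).
[cite: FitznerVanDerHofstad2017, (4.67) and (4.70) (arXiv:1506.07977v2 pp. 44–45)] -/
def jointWitIII (ι : Fin d × Bool) (z t x : Site d) : Set (Fin 2 → BondConfig (Site d)) :=
  {ω | s((0 : Site d), stepVec ι) ∈ ω 0} ∩ jointWit 0 (stepVec ι) 0 z t x

/-- Measurability. [folklore] -/
theorem measurableSet_jointWitIII (ι : Fin d × Bool) (z t x : Site d) : MeasurableSet (jointWitIII ι z t x) :=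
  (show MeasurableSet {ω : Fin 2 → BondConfig (Site d) | s((0 : Site d), stepVec ι) ∈ ω 0} from
    (measurableSet_mem (s((0 : Site d), stepVec ι))).preimage (measurable_pi_apply 0)).inter
    (measurableSet_jointWit _ _ _ _ _ _)

/-- `b_ι` is a lattice bond. [folklore] -/
theorem stepVec_mem_edgeSet (ι : Fin d × Bool) : s((0 : Site d), stepVec ι) ∈ (zdGraph d).edgeSet :=
  (SimpleGraph.mem_edgeSet _).2 ((zdGraph_adj_iff_stepVec 0 _).2 ⟨ι, by simp⟩)

/-- **Bond absorption for the `F^{ι,III}_0` part**: `p ℙ_p^{⊗2}(jointWit (0,e_ι) 0 z t x) = ℙ_p^{⊗2}(jointWitIII ι z t x)`.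
[cite: FitznerVanDerHofstad2017, §6.1, sentence after (6.4) (arXiv:1506.07977v2 p. 58)] -/
theorem ofReal_mul_piPerc_jointWit_origin (p : unitInterval) (ι : Fin d × Bool) (z t x : Site d) :
    ENNReal.ofReal p * piPerc d p 2 (jointWit 0 (stepVec ι) 0 z t x) = piPerc d p 2 (jointWitIII ι z t x) := by
  have h := ofReal_mul_piPerc_preimage_eraseAt0 p (stepVec_mem_edgeSet ι)
    (measurableSet_jointWit 0 (stepVec ι) 0 z t x)
  rwa [eraseAt0_preimage_jointWit] at h

/-- **The `F^{ι,III}_0` part of `Ξ^{(1),ι}(x)` is bounded by its two-level bounding event**: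
`p 𝔼_0^{b_ι}[𝟙{e_ι ∉ C̃^{b_ι}_0(0)} Ξ^{B(0),(0)}(e_ι,x;C̃^{b_ι}_0(0))] ≤ Σ_{z,t} ℙ_p^{⊗2}(jointWitIII ι z t x)`.
[cite: FitznerVanDerHofstad2017, (4.70) second summand, N = 1 (arXiv:1506.07977v2 p. 45)] -/
theorem ofReal_mul_nobleIotaCorr_zero_le (p : unitInterval) (ι : Fin d × Bool) (x : Site d) :
    ENNReal.ofReal p * nobleIotaCorr d p (stepVec ι) (fun C => nobleXiBT d p (bondsAt {0}) {0} 0 C (stepVec ι) x) ≤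
      ∑' z : Site d, ∑' t : Site d, piPerc d p 2 (jointWitIII ι z t x) := by
  have h0e : (0 : Site d) ≠ stepVec ι := ((zdGraph_adj_iff_stepVec 0 _).2 ⟨ι, by simp⟩).ne
  have hw : ∀ w : Site d, w ≠ 0 → ∀ z t : Site d, jointWit 0 (stepVec ι) w z t x = ∅ := fun w hw z t =>
    jointWit_eq_empty_of_not fun h => hw (h.1 rfl)
  rw [nobleIotaCorr_zero_eq_prod_twoLevel]
  calc ENNReal.ofReal p * ((bondPercolation (zdGraph d) p).prod (bondPercolation (zdGraph d) p)) (twoLevel 0 (stepVec ι) x)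
      ≤ ENNReal.ofReal p * ∑' w : Site d, ∑' z : Site d, ∑' t : Site d,
          piPerc d p 2 (jointWit 0 (stepVec ι) w z t x) :=
        mul_le_mul' le_rfl (prod_twoLevel_le_tsum_pi_jointWit p h0e x)
    _ = ENNReal.ofReal p * ∑' z : Site d, ∑' t : Site d, piPerc d p 2 (jointWit 0 (stepVec ι) 0 z t x) := by
        rw [tsum_eq_single (0 : Site d) (fun w hw' => by simp only [hw w hw', measure_empty, tsum_zero])]
    _ = ∑' z : Site d, ∑' t : Site d, piPerc d p 2 (jointWitIII ι z t x) := by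
        rw [← ENNReal.tsum_mul_left]
        refine tsum_congr fun z => ?_
        rw [← ENNReal.tsum_mul_left]
        exact tsum_congr fun t => ofReal_mul_piPerc_jointWit_origin p ι z t x

/-- **The `E₃`-half of hypothesis `h1` of `nobleXiIotaT_one_le_blocks_of_cls`**:
`Ξ^{(1),ι}(x) ≤ Ξ^{b_ι,(1)}(0,x;{e_ι}) + Σ_{z,t} ℙ_p^{⊗2}(jointWitIII ι z t x)`.
[cite: FitznerVanDerHofstad2017, (3.55) and (4.70), N = 1 (arXiv:1506.07977v2 pp. 30, 45)] -/
theorem nobleXiIotaT_one_le_add_partIII (p : unitInterval) (ι : Fin d × Bool) (x : Site d) :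
    nobleXiIotaT d p (stepVec ι) 1 x ≤ nobleXiBT d p {s(0, stepVec ι)} ∅ 1 {stepVec ι} 0 x +
      ∑' z : Site d, ∑' t : Site d, piPerc d p 2 (jointWitIII ι z t x) := by
  have h : nobleXiIotaT d p (stepVec ι) 1 x = nobleXiBT d p {s(0, stepVec ι)} ∅ 1 {stepVec ι} 0 x +
      ENNReal.ofReal p * nobleIotaCorr d p (stepVec ι)
        (fun C => nobleXiBT d p (bondsAt {0}) {0} 0 C (stepVec ι) x) := rfl
  rw [h]
  exact add_le_add le_rfl (ofReal_mul_nobleIotaCorr_zero_le p ι x)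

/-! ### C. The classes of the `F^{ι,III}_0` part are the classes `(0,b)` of `Ξ^{(1)}` at `(u,v,w) = (0,e_ι,0)` -/

/-- Class `b` of the last line on `jointWitIII` is class `(0,b)` on `jointWit (0,e_ι) 0` (the first line `{0↔0}`
is trivial). [cite: FitznerVanDerHofstad2017, §6.1 "Case a = 0 … w = u = 0" (arXiv:1506.07977v2 p. 59)] -/
theorem jointWitIII_inter_lineCls (ι : Fin d × Bool) (z t x : Site d) (b : Fin 3) :
    jointWitIII ι z t x ∩ lineCls t z 1 b =
      {ω | s((0 : Site d), stepVec ι) ∈ ω 0} ∩ (jointWit 0 (stepVec ι) 0 z t x ∩ clsSet 0 0 t z 0 b) := by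
  ext ω
  simp only [jointWitIII, Set.mem_inter_iff, Set.mem_setOf_eq, mem_clsSet_iff, mem_lineCls_zero_iff]
  tauto

/-- `P^{S,0}(0,0) = 1`. [cite: FitznerVanDerHofstad2017, App. B Table "P^{S,b}" row b = 0 (arXiv:1506.07977v2 p. 73)] -/
theorem blockPS_zero_origin (L : Letters d) : blockPS L 0 (0 : Site d) 0 = 1 := by
  rw [blockPS_zero, kd_self, one_mul]
  simp [Letters.pdbc]

/-- **Hypothesis `h3 b` of `nobleXiIotaT_one_le_blocks_of_cls` from the class estimate `(0,b)` of `Ξ^{(1)}`** at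
`(u,v,w) = (0,e_ι,0)`: `ℙ_p^{⊗2}(jointWitIII ∩ class b) ≤ Ā'^{ι,0,b}(0,0,t,z) P^{E,b}(t−x,z−x)`
(`J(e_ι) = p` is the occupied `b_ι`; `P^{S,0}(0,0) = 1`; `𝟙{e_ι = e_κ} = δ_{κ,ι}`).
[cite: FitznerVanDerHofstad2017, §6.1 proof of Lemma 5.3, "If F^{ι,III}_0 occurs, then we have w=u=0 and κ=ι" (arXiv:1506.07977v2 p. 59)] -/
theorem jointWitIII_cls_of (p : unitInterval) (ι : Fin d × Bool) (x z t : Site d) (b : Fin 3)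
    (h : ENNReal.ofReal (bondJ d p (stepVec ι - 0)) *
        piPerc d p 2 (jointWit 0 (stepVec ι) 0 z t x ∩ clsSet 0 0 t z 0 b) ≤
      ∑ κ : Fin d × Bool, (if stepVec ι = 0 + stepVec κ then (1 : ℝ≥0∞) else 0) *
        (blockPS (Letters.perc d p) 0 0 0 * blockAbar' (Letters.perc d p) κ 0 b 0 0 t z *
          blockPE (Letters.perc d p) b (t - x) (z - x))) :
    piPerc d p 2 (jointWitIII ι z t x ∩ lineCls t z 1 b) ≤
      blockAbar' (Letters.perc d p) ι 0 b 0 0 t z * blockPE (Letters.perc d p) b (t - x) (z - x) := by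
  classical
  have hJ : ENNReal.ofReal (bondJ d p (stepVec ι - 0)) = ENNReal.ofReal p := by rw [sub_zero, bondJ_stepVec]
  have hL : piPerc d p 2 (jointWitIII ι z t x ∩ lineCls t z 1 b) =
      ENNReal.ofReal p * piPerc d p 2 (jointWit 0 (stepVec ι) 0 z t x ∩ clsSet 0 0 t z 0 b) := by
    have h' := ofReal_mul_piPerc_preimage_eraseAt0 p (stepVec_mem_edgeSet ι)
      ((measurableSet_jointWit 0 (stepVec ι) 0 z t x).inter (measurableSet_clsSet 0 0 t z 0 b))
    rw [eraseAt0_preimage_jointWit_inter_clsSet] at h'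
    rw [jointWitIII_inter_lineCls, h']
  have hR : (∑ κ : Fin d × Bool, (if stepVec ι = 0 + stepVec κ then (1 : ℝ≥0∞) else 0) *
        (blockPS (Letters.perc d p) 0 0 0 * blockAbar' (Letters.perc d p) κ 0 b 0 0 t z *
          blockPE (Letters.perc d p) b (t - x) (z - x))) =
      blockAbar' (Letters.perc d p) ι 0 b 0 0 t z * blockPE (Letters.perc d p) b (t - x) (z - x) := by
    rw [Finset.sum_eq_single ι]
    · rw [if_pos (zero_add _).symm, one_mul, blockPS_zero_origin, one_mul]
    · intro κ _ hκ
      rw [if_neg, zero_mul]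
      rw [zero_add]
      exact fun h => hκ (stepVec_injective' h).symm
    · exact fun h => absurd (Finset.mem_univ ι) h
  rw [hL, ← hJ, ← hR]
  exact h

/-- **`h3`, class `b = 0`** (trivial last sausage), from `NobleBoundsN1Class00.jointWit_cls_0_0`.
[cite: FitznerVanDerHofstad2017, §6.1 "Case a = 0", "b = 0" (arXiv:1506.07977v2 pp. 58–59)] -/
theorem jointWitIII_cls_zero (p : unitInterval) (ι : Fin d × Bool) (x z t : Site d) :
    piPerc d p 2 (jointWitIII ι z t x ∩ lineCls t z 1 0) ≤
      blockAbar' (Letters.perc d p) ι 0 0 0 0 t z * blockPE (Letters.perc d p) 0 (t - x) (z - x) :=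
  jointWitIII_cls_of p ι x z t 0 (jointWit_cls_0_0 p x 0 (stepVec ι) 0 z t)

/-- **`h3`, class `b = 2`** (last line of length `≥ 2`), from `NobleBoundsN1Cls02.jointWit_cls_zero_two`.
[cite: FitznerVanDerHofstad2017, §6.1 "Case a = 0", "b ≥ 2" (arXiv:1506.07977v2 pp. 58–59)] -/
theorem jointWitIII_cls_two (p : unitInterval) (ι : Fin d × Bool) (x z t : Site d) :
    piPerc d p 2 (jointWitIII ι z t x ∩ lineCls t z 1 2) ≤
      blockAbar' (Letters.perc d p) ι 0 2 0 0 t z * blockPE (Letters.perc d p) 2 (t - x) (z - x) :=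
  jointWitIII_cls_of p ι x z t 2 (jointWit_cls_zero_two p x 0 (stepVec ι) 0 z t)

end Literature.Probability.FitznerVanDerHofstad2017

end
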